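import Summits.HodgeConjecture.HodgeConjecture.Theorems.F0P3cStCharTSTorusChartIso     -- ★ «CHART-ISO★» + P5 (torusChartEquiv, Haar transport, calibration constant)
import Summits.HodgeConjecture.HodgeConjecture.Theorems.F0P3cStCharTSTorusRay          -- ★ p849400 HAND 2 (`measurePreserving_reflect`, `measurableEmbedding_reflect`)
import Literature.NumberTheory.Automorphic.CMBorelWeylTorusConjugate                 -- ★ Weyl conjugation on the torus (`glDiagonal_rev_eq_weylConj`, `cmTorusCharPair_weylConj`)
import Literature.NumberTheory.Automorphic.CMPrincipalSeriesOpenCellSection             -- ★ `exists_coe_eq_antidiagonal` (the Weyl element `w₀`)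
import Literature.NumberTheory.Automorphic.CMTorusRegularAEPairwise                   -- ★ `ae_isUnit_torusEntry_sub_three`
import Literature.NumberTheory.Automorphic.UnitaryGroupFormCongrFinSum                -- ★ `formCongr_one_eq`
import Literature.NumberTheory.Rogawski1990.CMCharIdentityClauses                       -- ★ organ vocabulary (`Gqs`, `qsForm`)
import HarnessLib

/-!
# F0 · P3c · line LH6 «StCharTS» — «PSM★»: van Dijk's formula in PRINT'S SPLIT-TORUS FORM for the CONCRETE torus transform
# `Tr i_G(χ)(φ) = ∫_M F_φ·χ̃ dμM + ∫_M F_φ·(wχ)~ dμM`, `F_φ = torusTransform`  [Rogawski1990, §12.7 L. 12.7.2 (proof) p. 193; §4.9 (4.9.4) p. 56; §12.2 p. 173]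

Cell `pub/hodgecm-mathlib`, crux H413 = `stmt-HodgeConjecture-24833` (`--supports` lane), route HCCMUnconditional; seat LH6-p01 (g2), integrator of the (TOR) road
(desk F0P3b-plan (g23) 05:28:37Z); census `F0/P3b/LH6-p01/g2/CENSUS-PSM.v2-TERMS.md`.  THEOREMS ONLY, sorry-free.  HONEST LABEL: HC_CM is proved only modulo the 7 printed
citations (2 remaining: hLiu418 = stmt-HodgeConjecture-24832, h413 = stmt-HodgeConjecture-24833) until rung 0 closes; count-neutral, hypothesis-fed: the W-invariance of van
Dijk's weight (`hW`, = LH6-p02 (g2)'s «VDW-SYMM★») is a NAMED hypothesis until that ★ lands.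
-/

set_option autoImplicit false
-- the mandated namespace has the single-problem summit's repeated segment (`HodgeConjecture.HodgeConjecture`)
set_option linter.dupNamespace false

noncomputable section

open NumberField IsDedekindDomain MeasureTheory MeasureTheory.Measure Filter Topology
open scoped Matrix MatrixGroups NNReal
open Literature.NumberTheory.Rogawski1990 Literature.NumberTheory.Automorphic Literature.NumberTheory.Automorphic.UnitaryGroup
open Literature.MeasureTheory.Group
open Summit.HodgeConjecture.HodgeConjecture.Cruxes.H413.F0P3cStCharTSTorusDefs
open Summit.HodgeConjecture.HodgeConjecture.Cruxes.H413.F0P3cStCharTSTorusChartIso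
open Summit.HodgeConjecture.HodgeConjecture.Cruxes.H413.F0P3cStCharTSTorusCompactPart
open Summit.HodgeConjecture.HodgeConjecture.Cruxes.H413.F0P3cStCharTSTorusRay

namespace Summit.HodgeConjecture.HodgeConjecture.Cruxes.H413.F0P3cStCharTSPsmTransport

variable (L : Type) [Field L] [NumberField L] [IsCMField L] (v : HeightOneSpectrum (𝓞 ↥(maximalRealSubfield L)))

/-! ## §1 The chart intertwines the W-reflection of `M` with Weyl conjugation on `T` -/

/-- **`ι(ω m) = w₀ · ι(m) · w₀⁻¹`** for the Weyl element `w₀` (matrix `Φ₃`): ★ `torusChartEntries_reflect` (reversed entries) + ★ `glDiagonal_rev_eq_weylConj`.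
[cite: Rogawski1990, §12.2 p. 173; §1.10 p. 9] -/
theorem torusChart_reflect (w₀ : ↥(unitaryGroupOfForm (conjLocal L (IsCMField.complexConj L) v) (cmLocalForm L 3 v)))
    (hw₀ : Units.val (w₀ : GL (Fin 3) (LocalRing L v)) = cmLocalForm L 3 v)
    (m : (LocalRing L v)ˣ × ↥(normOneUnits (conjLocal L (IsCMField.complexConj L) v))) :
    torusChart L v ((Units.map ((conjLocal L (IsCMField.complexConj L) v : LocalRing L v →+* LocalRing L v) : LocalRing L v →* LocalRing L v) m.1)⁻¹, m.2) =
      ⟨w₀ * ((torusChart L v m : ↥(cmBorelTriple L 3 v).M) : ↥(unitaryGroupOfForm (conjLocal L (IsCMField.complexConj L) v) (cmLocalForm L 3 v))) * w₀⁻¹,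
        weylConj_mem_cmTorus L v w₀ hw₀ (torusChart L v m)⟩ := by
  apply Subtype.ext; apply Subtype.ext
  rw [coe_torusChart]
  have hrev : torusChartEntries L v ((Units.map ((conjLocal L (IsCMField.complexConj L) v : LocalRing L v →+* LocalRing L v) :
      LocalRing L v →* LocalRing L v) m.1)⁻¹, m.2) = fun i => torusChartEntries L v m (Fin.rev i) :=
    funext fun i => torusChartEntries_reflect L v m i
  rw [hrev]
  exact glDiagonal_rev_eq_weylConj (conjLocal L (IsCMField.complexConj L) v) (cmLocalForm_eq_over L 3 v) w₀ hw₀ (torusChart L v m) (coe_torusChart L v m).symm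

/-! ## §2 The workhorse: (4.9.4) on `U(Φ₃)(L⁺_v)` with the weight `vanDijkWeight` and the organ's canonical orbital integrals -/

set_option maxHeartbeats 1600000 in
/-- **`Tr i_G(χ)(φ) = μ_T(T ∩ K_v)⁻¹ · ∫_T χ(t) · Δ(t) · Φ^{can}(t, φ) dμ_T`** for every continuous `χ : T →* ℂˣ`, every Haar `μ_T` on `T` and every locally constant compactly
supported `φ` — ★ `smoothTrace_cmPrincipalSeries_map_symm_eq_inv_mul_integral` at the identity frame of `U(Φ₃)(L⁺_v)` with `Φ := χ · vanDijkWeight · O^{can}` (the `dite`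
of ★ `vanDijkWeight` is `μ_T`-a.e. in its regular branch, ★ `ae_isUnit_torusEntry_sub_three`). [cite: Rogawski1990, §4.9 (4.9.4) p. 56; §12.7 L. 12.7.2 (proof) p. 193] -/
theorem smoothTrace_eq_inv_mul_integral_vanDijkWeight
    (hns : ∀ w : PlacesOver L v, IsCMField.complexConj L • w.1 = w.1)
    [MeasurableSpace (Gqs L v)] [BorelSpace (Gqs L v)]
    [∀ γ : Gqs L v, MeasurableSpace (Gqs L v ⧸ Subgroup.centralizer ({γ} : Set (Gqs L v)))]
    [∀ γ : Gqs L v, BorelSpace (Gqs L v ⧸ Subgroup.centralizer ({γ} : Set (Gqs L v)))]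
    (νQv : Measure (Gqs L v)) [νQv.IsHaarMeasure] [νQv.IsMulRightInvariant]
    (mQv : OrbitalMeasureFamily (Gqs L v))
    (hcanQ : mQv.IsCanonical (fun γ => IsRegularElt (γ.val : GL (Fin 3) (UnitaryGroup.LocalRing L v))) νQv)
    (χ : ↥(cmBorelTriple L 3 v).M →* ℂˣ) (hχ : Continuous fun t => ((χ t : ℂˣ) : ℂ))
    (φ : Gqs L v → ℂ) (hφ : IsLocallyConstant φ) (hφc : HasCompactSupport φ) :
    letI : MeasurableSpace ↥(unitaryGroupOfForm (conjLocal L (IsCMField.complexConj L) v) (cmLocalForm L 3 v)) := ‹MeasurableSpace (Gqs L v)›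
    ∀ (μT : Measure ↥(cmBorelTriple L 3 v).M) [μT.IsHaarMeasure],
    Representation.smoothTrace (G := Gqs L v) (UnitaryGroup.cmPrincipalSeries L 3 v χ) νQv φ =
      (((μT.real {t : ↥(cmBorelTriple L 3 v).M |
          (t : ↥(unitaryGroupOfForm (conjLocal L (IsCMField.complexConj L) v) (cmLocalForm L 3 v))) ∈
            cmLocalIntegralLevel L 3 (Matrix.of fun i j : Fin 3 => if i.val + j.val + 1 = 3 then (1 : L) else 0) v})⁻¹ : ℝ) : ℂ) *
        ∫ t, ((χ t : ℂˣ) : ℂ) * (vanDijkWeight L v t *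
          classOrbitalIntegral mQv φ (ConjClasses.mk ((t : ↥(unitaryGroupOfForm (conjLocal L (IsCMField.complexConj L) v) (cmLocalForm L 3 v))) : Gqs L v))) ∂μT := by
  intro μT _
  obtain ⟨w⟩ := (inferInstance : Nonempty (PlacesOver L v))
  have hw : IsCMField.complexConj L • w.1 = w.1 := hns w
  -- the organ's measurable structure on `Gqs L v`, re-read on the (definitionally equal) matrix carrier
  letI hmsU : MeasurableSpace ↥(unitaryGroupOfForm (conjLocal L (IsCMField.complexConj L) v) (cmLocalForm L 3 v)) := ‹MeasurableSpace (Gqs L v)›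
  haveI : BorelSpace ↥(unitaryGroupOfForm (conjLocal L (IsCMField.complexConj L) v) (cmLocalForm L 3 v)) := ⟨BorelSpace.measurable_eq (α := Gqs L v)⟩
  haveI := locallyCompactSpace_cmBorelU L 3 v
  -- the identity frame
  have h1 : formCongr (conjLocal L (IsCMField.complexConj L) v) (1 : GL (Fin 3) (UnitaryGroup.LocalRing L v)) ((qsForm L).map (algebraMap L (UnitaryGroup.LocalRing L v))) =
      (1 : UnitaryGroup.LocalRing L v) • (Matrix.of fun i j : Fin 3 => if i.val + j.val + 1 = 3 then (1 : L) else 0).map (algebraMap L (UnitaryGroup.LocalRing L v)) := by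
    rw [formCongr_one_eq, one_smul]
  have he : ∀ g, (cmDatumLocalCongr L v (1 : GL (Fin 3) (UnitaryGroup.LocalRing L v)) isUnit_one h1) g = g := fun g => by
    apply Subtype.ext
    rw [coe_cmDatumLocalCongr_apply, inv_one, mul_one, one_mul]
  have hes : ∀ g, (cmDatumLocalCongr L v (1 : GL (Fin 3) (UnitaryGroup.LocalRing L v)) isUnit_one h1).symm g = g := fun g => by
    conv_lhs => rw [← he g]
    exact (cmDatumLocalCongr L v (1 : GL (Fin 3) (UnitaryGroup.LocalRing L v)) isUnit_one h1).symm_apply_apply g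
  have hecoe : (fun x : ↥(unitaryGroupOfForm (conjLocal L (IsCMField.complexConj L) v) (cmLocalForm L 3 v)) =>
      φ ((cmDatumLocalCongr L v (1 : GL (Fin 3) (UnitaryGroup.LocalRing L v)) isUnit_one h1) x)) = φ := funext fun x => by rw [he]
  have hmap : (Measure.map (⇑(cmDatumLocalCongr L v (1 : GL (Fin 3) (UnitaryGroup.LocalRing L v)) isUnit_one h1).symm) νQv :
      Measure ↥(unitaryGroupOfForm (conjLocal L (IsCMField.complexConj L) v) (cmLocalForm L 3 v))) = νQv := by
    have : (⇑(cmDatumLocalCongr L v (1 : GL (Fin 3) (UnitaryGroup.LocalRing L v)) isUnit_one h1).symm :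
        (UnitaryGroup.cmDatum L 3 (qsForm L)).Local v → ↥(unitaryGroupOfForm (conjLocal L (IsCMField.complexConj L) v) (cmLocalForm L 3 v))) = id := funext hes
    rw [this]
    exact Measure.map_id
  -- the a.e. identification of `Φ := χ · vanDijkWeight · O^{can}` with the ★ integrand
  have hae : ∀ᵐ (t : ↥(cmBorelTriple L 3 v).M) ∂μT, ∀ (d : Fin 3 → (UnitaryGroup.LocalRing L v)ˣ)
      (hd : glDiagonal 3 (UnitaryGroup.LocalRing L v) d =
        ((t : ↥(unitaryGroupOfForm (conjLocal L (IsCMField.complexConj L) v) (cmLocalForm L 3 v))) : GL (Fin 3) (UnitaryGroup.LocalRing L v)))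
      (ha' : IsUnit ((((d 0)⁻¹ * d 1 : (UnitaryGroup.LocalRing L v)ˣ) : UnitaryGroup.LocalRing L v) - 1))
      (hb' : IsUnit ((((d 0)⁻¹ * d 2 : (UnitaryGroup.LocalRing L v)ˣ) : UnitaryGroup.LocalRing L v) - 1)),
      ((χ t : ℂˣ) : ℂ) * (vanDijkWeight L v t *
          classOrbitalIntegral mQv φ (ConjClasses.mk ((t : ↥(unitaryGroupOfForm (conjLocal L (IsCMField.complexConj L) v) (cmLocalForm L 3 v))) : Gqs L v))) =
        ((χ t : ℂˣ) : ℂ) *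
          ((rootDeltaChar (cmBorelTriple L 3 v).P
            ⟨(t : ↥(unitaryGroupOfForm (conjLocal L (IsCMField.complexConj L) v) (cmLocalForm L 3 v))), (cmBorelTriple L 3 v).M_le t.2⟩ : ℂˣ) : ℂ) *
        (((letI : MeasurableSpace (UnitaryGroup.LocalRing L v) := borel _; haveI : BorelSpace (UnitaryGroup.LocalRing L v) := ⟨rfl⟩
          haveI : SecondCountableTopology (UnitaryGroup.LocalRing L v) := secondCountableTopology_localRing (E := L) v
          ((distribHaarChar (UnitaryGroup.LocalRing L v) ha'.unit)⁻¹ *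
            (HeisRing.skewModulus (conjLocal L (IsCMField.complexConj L) v) (continuous_conjLocal L (IsCMField.complexConj L) v) hb'.unit
              (HeisRing.map_unit_torusCentralScalar_sub_one (conjLocal L (IsCMField.complexConj L) v) (cmLocalForm_eq_over L 3 v) t hd hb'))⁻¹ :
                NNReal)) : ℝ) : ℂ)⁻¹ *
        classOrbitalIntegral mQv φ
          (ConjClasses.mk ((cmDatumLocalCongr L v (1 : GL (Fin 3) (UnitaryGroup.LocalRing L v)) isUnit_one h1)
            (t : ↥(unitaryGroupOfForm (conjLocal L (IsCMField.complexConj L) v) (cmLocalForm L 3 v))))) := by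
    filter_upwards with t
    intro d hd ha' hb'
    -- `d` IS the tuple of torus entries of `t`
    obtain rfl : d = fun i => torusEntry (conjLocal L (IsCMField.complexConj L) v) (cmLocalForm L 3 v) i t :=
      funext fun i => (torusEntry_eq_of_glDiagonal_eq _ _ i t d hd).symm
    rw [he, vanDijkWeight, dif_pos ⟨ha', hb'⟩]
    ring
  -- van Dijk against canonical orbital integrals
  have key := smoothTrace_cmPrincipalSeries_map_symm_eq_inv_mul_integral L (qsForm L) (antidiagOne_isHermitian L 3) (isUnit_antidiagOne_det L 3) w hw
    (1 : GL (Fin 3) (UnitaryGroup.LocalRing L v)) isUnit_one h1 νQv hcanQ χ hχ μT φ hφ hφc _ hae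
  rw [hmap, hecoe] at key
  exact key

/-! ## §3 «PSM★»: the (PSM) clause of the concrete (S-a) head for `Ftr := torusTransform`, `toC := pairChar` -/

set_option maxHeartbeats 1600000 in
/-- **«PSM★» — VAN DIJK IN PRINT'S SPLIT-TORUS FORM** [p. 193 display]: for every continuous pair `χ = (χ₁, χ₂)`, every Haar measure `μM` on `M = E_vˣ × E¹_v` and every locally
constant compactly supported `φ` on `U(Φ₃)(L⁺_v)` (`v` non-split),
`Tr i_G(χ)(φ) = ∫_M F_φ(m)·χ̃(m) dμM + ∫_M F_φ(m)·(wχ)~(m) dμM` with `F_φ = torusTransform L v mQv μM φ` (★ p849564) and `χ̃ = pairChar L v χ` — i.e. the (PSM) conjunct of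
(TOR) in ★ p849458 ∕ leaf ED. 5 with `Ftr := torusTransform`, `toC := pairChar`, for EVERY `Ω` (the support hypothesis is not used).  INPUTS: the workhorse (4.9.4) twice
(at `χ` and at `wχ = (χ̄₁⁻¹, χ₂)`, ★ `cmWeylTorusCharPair_eq`), Haar transport along the chart (★ «CHART-ISO★»: `μ_T := ι_* μM`, `μ_T(T ∩ K_v) = μM(M_c)`), the
`μM`-invariance of the W-reflection `ω` (★ HAND 2) with `ι ∘ ω = ʷ(·) ∘ ι` (§1), and the W-INVARIANCE OF VAN DIJK'S WEIGHT `hW` (= LH6-p02 (g2)'s «VDW-SYMM★», a NAMED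
hypothesis here) — which together give `Tr i_G(wχ) = Tr i_G(χ)` [§12.2 p. 173 «`i_G(χ)` and `i_G(wχ)` have the same constituents»].
[cite: Rogawski1990, §12.7 L. 12.7.2 (proof) p. 193; §4.9 (4.9.4) p. 56; §12.2 p. 173] [cite: vanDijk1972, Thm. p. 237] -/
theorem psm_torusTransform
    (hns : ∀ w : PlacesOver L v, IsCMField.complexConj L • w.1 = w.1)
    [MeasurableSpace (Gqs L v)] [BorelSpace (Gqs L v)]
    [∀ γ : Gqs L v, MeasurableSpace (Gqs L v ⧸ Subgroup.centralizer ({γ} : Set (Gqs L v)))]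
    [∀ γ : Gqs L v, BorelSpace (Gqs L v ⧸ Subgroup.centralizer ({γ} : Set (Gqs L v)))]
    (νQv : Measure (Gqs L v)) [νQv.IsHaarMeasure] [νQv.IsMulRightInvariant]
    (mQv : OrbitalMeasureFamily (Gqs L v))
    (hcanQ : mQv.IsCanonical (fun γ => IsRegularElt (γ.val : GL (Fin 3) (UnitaryGroup.LocalRing L v))) νQv)
    [MeasurableSpace ((LocalRing L v)ˣ × ↥(normOneUnits (conjLocal L (IsCMField.complexConj L) v)))] [BorelSpace ((LocalRing L v)ˣ × ↥(normOneUnits (conjLocal L (IsCMField.complexConj L) v)))]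
    (μM : Measure ((LocalRing L v)ˣ × ↥(normOneUnits (conjLocal L (IsCMField.complexConj L) v)))) [μM.IsHaarMeasure]
    -- ══ «VDW-SYMM★» (LH6-p02 (g2)): the W-invariance of van Dijk's weight, for the Weyl element `w₀` with matrix `Φ₃` ══
    (hW : ∀ (w₀ : ↥(unitaryGroupOfForm (conjLocal L (IsCMField.complexConj L) v) (cmLocalForm L 3 v))) (hw₀ : Units.val (w₀ : GL (Fin 3) (LocalRing L v)) = cmLocalForm L 3 v) (t : ↥(cmBorelTriple L 3 v).M),
      vanDijkWeight L v ⟨w₀ * (t : ↥(unitaryGroupOfForm (conjLocal L (IsCMField.complexConj L) v) (cmLocalForm L 3 v))) * w₀⁻¹, weylConj_mem_cmTorus L v w₀ hw₀ t⟩ = vanDijkWeight L v t) :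
    ∀ χ : (((UnitaryGroup.LocalRing L v)ˣ →* ℂˣ) × (↥(normOneUnits (conjLocal L (IsCMField.complexConj L) v)) →* ℂˣ)), Continuous χ.1 → Continuous χ.2 →
      ∀ φ : Gqs L v → ℂ, IsLocSmooth φ ∧ tsupport φ ⊆ hyperbolicSet L v →
        Representation.smoothTrace (G := Gqs L v) (UnitaryGroup.cmPrincipalSeries L 3 v (UnitaryGroup.cmTorusCharPair L v χ.1 χ.2)) νQv φ =
          (∫ m, torusTransform L v mQv μM φ m * (((pairChar L v χ) m : ℂˣ) : ℂ) ∂μM) +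
            ∫ m, torusTransform L v mQv μM φ m * (((pairChar L v (conjInvChar (conjLocal L (IsCMField.complexConj L) v) χ.1, χ.2)) m : ℂˣ) : ℂ) ∂μM := by
  intro χ hχ1 hχ2 φ hφ
  -- the organ's measurable structure on `Gqs L v`, re-read on the matrix carrier (so `T` inherits it)
  letI hmsU : MeasurableSpace ↥(unitaryGroupOfForm (conjLocal L (IsCMField.complexConj L) v) (cmLocalForm L 3 v)) := ‹MeasurableSpace (Gqs L v)›
  haveI : BorelSpace ↥(unitaryGroupOfForm (conjLocal L (IsCMField.complexConj L) v) (cmLocalForm L 3 v)) := ⟨BorelSpace.measurable_eq (α := Gqs L v)⟩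
  -- the Weyl element
  obtain ⟨w₀, hw₀'⟩ := exists_coe_eq_antidiagonal L (IsCMField.complexConj L) 3 v (cmLocalForm_eq_over L 3 v)
  have hw₀ : Units.val (w₀ : GL (Fin 3) (LocalRing L v)) = cmLocalForm L 3 v := by rw [hw₀', cmLocalForm_eq_over]
  -- the transported Haar measure `μ_T := ι_* μM` and its calibration constant
  haveI hμT : (μM.map (torusChart L v)).IsHaarMeasure := isHaarMeasure_map_torusChart L v μM
  have hcal := map_torusChart_real_level_eq L v hns μM
  -- the two characters of `T` and their continuity
  have hχc : Continuous fun t => ((UnitaryGroup.cmTorusCharPair L v χ.1 χ.2 t : ℂˣ) : ℂ) :=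
    continuous_cmTorusCharPair_apply L v χ.1 χ.2 (Units.continuous_val.comp hχ1) (Units.continuous_val.comp hχ2)
  have hwχ1 : Continuous (conjInvChar (conjLocal L (IsCMField.complexConj L) v) χ.1) := by
    have : (⇑(conjInvChar (conjLocal L (IsCMField.complexConj L) v) χ.1)) = fun x => (χ.1 (Units.map ((conjLocal L (IsCMField.complexConj L) v :
        LocalRing L v →+* LocalRing L v) : LocalRing L v →* LocalRing L v) x))⁻¹ := funext fun x => conjInvChar_apply _ _ _
    rw [this]
    exact (hχ1.comp (Continuous.units_map _ (continuous_conjLocal L (IsCMField.complexConj L) v))).inv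
  have hwχc : Continuous fun t => ((UnitaryGroup.cmTorusCharPair L v (conjInvChar (conjLocal L (IsCMField.complexConj L) v) χ.1) χ.2 t : ℂˣ) : ℂ) :=
    continuous_cmTorusCharPair_apply L v _ χ.2 (Units.continuous_val.comp hwχ1) (Units.continuous_val.comp hχ2)
  -- (1)+(2): the workhorse at `χ` and at `wχ`, in torus form then pulled back to `M` along the chart
  have h1 := smoothTrace_eq_inv_mul_integral_vanDijkWeight L v hns νQv mQv hcanQ (UnitaryGroup.cmTorusCharPair L v χ.1 χ.2) hχc φ hφ.1.1 hφ.1.2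
    (μM.map (torusChart L v))
  have h2 := smoothTrace_eq_inv_mul_integral_vanDijkWeight L v hns νQv mQv hcanQ
    (UnitaryGroup.cmTorusCharPair L v (conjInvChar (conjLocal L (IsCMField.complexConj L) v) χ.1) χ.2) hwχc φ hφ.1.1 hφ.1.2 (μM.map (torusChart L v))
  rw [hcal, integral_comp_torusChart] at h1 h2
  -- the weight × orbital integral is constant on `{ι m, ι (ω m)}` («VDW-SYMM★» + class invariance + §1)
  have hG : ∀ m : ((LocalRing L v)ˣ × ↥(normOneUnits (conjLocal L (IsCMField.complexConj L) v))),
      vanDijkWeight L v (torusChart L v ((fun p : ((LocalRing L v)ˣ × ↥(normOneUnits (conjLocal L (IsCMField.complexConj L) v))) => ((Units.map ((conjLocal L (IsCMField.complexConj L) v : LocalRing L v →+* LocalRing L v) : LocalRing L v →* LocalRing L v) p.1)⁻¹, p.2)) m)) *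
          classOrbitalIntegral mQv φ (ConjClasses.mk (((torusChart L v ((fun p : ((LocalRing L v)ˣ × ↥(normOneUnits (conjLocal L (IsCMField.complexConj L) v))) => ((Units.map ((conjLocal L (IsCMField.complexConj L) v : LocalRing L v →+* LocalRing L v) : LocalRing L v →* LocalRing L v) p.1)⁻¹, p.2)) m) : ↥(cmBorelTriple L 3 v).M) : ↥(unitaryGroupOfForm (conjLocal L (IsCMField.complexConj L) v) (cmLocalForm L 3 v))) : Gqs L v)) =
        vanDijkWeight L v (torusChart L v m) *
          classOrbitalIntegral mQv φ (ConjClasses.mk (((torusChart L v m : ↥(cmBorelTriple L 3 v).M) : ↥(unitaryGroupOfForm (conjLocal L (IsCMField.complexConj L) v) (cmLocalForm L 3 v))) : Gqs L v)) := by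
    intro m
    rw [torusChart_reflect L v w₀ hw₀ m, hW w₀ hw₀]
    congr 2
    refine ConjClasses.mk_eq_mk_iff_isConj.2 (isConj_iff.2 ⟨((w₀⁻¹ : ↥(unitaryGroupOfForm (conjLocal L (IsCMField.complexConj L) v) (cmLocalForm L 3 v))) : Gqs L v), ?_⟩)
    show ((w₀⁻¹ * (w₀ * ((torusChart L v m : ↥(cmBorelTriple L 3 v).M) : ↥(unitaryGroupOfForm (conjLocal L (IsCMField.complexConj L) v) (cmLocalForm L 3 v))) * w₀⁻¹) * w₀⁻¹⁻¹ : ↥(unitaryGroupOfForm (conjLocal L (IsCMField.complexConj L) v) (cmLocalForm L 3 v))) : Gqs L v) =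
      (((torusChart L v m : ↥(cmBorelTriple L 3 v).M) : ↥(unitaryGroupOfForm (conjLocal L (IsCMField.complexConj L) v) (cmLocalForm L 3 v))) : Gqs L v)
    group
  -- the `wχ`-integral equals the `χ`-integral: substitute `m ↦ ω m` (★ HAND 2: `ω` preserves `μM`)
  have hsub : ∫ m, ((UnitaryGroup.cmTorusCharPair L v (conjInvChar (conjLocal L (IsCMField.complexConj L) v) χ.1) χ.2 (torusChart L v m) : ℂˣ) : ℂ) *
        (vanDijkWeight L v (torusChart L v m) *
          classOrbitalIntegral mQv φ (ConjClasses.mk (((torusChart L v m : ↥(cmBorelTriple L 3 v).M) : ↥(unitaryGroupOfForm (conjLocal L (IsCMField.complexConj L) v) (cmLocalForm L 3 v))) : Gqs L v))) ∂μM =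
      ∫ m, ((UnitaryGroup.cmTorusCharPair L v χ.1 χ.2 (torusChart L v m) : ℂˣ) : ℂ) *
        (vanDijkWeight L v (torusChart L v m) *
          classOrbitalIntegral mQv φ (ConjClasses.mk (((torusChart L v m : ↥(cmBorelTriple L 3 v).M) : ↥(unitaryGroupOfForm (conjLocal L (IsCMField.complexConj L) v) (cmLocalForm L 3 v))) : Gqs L v))) ∂μM := by
    have hint := (measurePreserving_reflect L v μM).integral_comp (measurableEmbedding_reflect L v)
      (fun m : ((LocalRing L v)ˣ × ↥(normOneUnits (conjLocal L (IsCMField.complexConj L) v))) => ((UnitaryGroup.cmTorusCharPair L v χ.1 χ.2 (torusChart L v m) : ℂˣ) : ℂ) *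
        (vanDijkWeight L v (torusChart L v m) *
          classOrbitalIntegral mQv φ (ConjClasses.mk (((torusChart L v m : ↥(cmBorelTriple L 3 v).M) : ↥(unitaryGroupOfForm (conjLocal L (IsCMField.complexConj L) v) (cmLocalForm L 3 v))) : Gqs L v))))
    rw [← hint]
    refine integral_congr_ae (Filter.Eventually.of_forall fun m => ?_)
    simp only
    rw [hG m, cmTorusCharPair_torusChart, cmTorusCharPair_torusChart, conjInvChar_apply, map_inv]
  -- the two `M`-side integrands of (PSM), rewritten through `pairChar = χ ∘ ι` and the definition of `torusTransform`
  have hF : ∀ (ψ : (((UnitaryGroup.LocalRing L v)ˣ →* ℂˣ) × (↥(normOneUnits (conjLocal L (IsCMField.complexConj L) v)) →* ℂˣ))) (m : ((LocalRing L v)ˣ × ↥(normOneUnits (conjLocal L (IsCMField.complexConj L) v)))),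
      torusTransform L v mQv μM φ m * (((pairChar L v ψ) m : ℂˣ) : ℂ) =
        (((2 * μM.real ((((Submonoid.pi Set.univ (fun w : PlacesOver L v => (w.1.adicCompletionIntegers L).toSubring.toSubmonoid)).units.prod (⊤ : Subgroup ↥(normOneUnits (conjLocal L (IsCMField.complexConj L) v)))) : Subgroup ((LocalRing L v)ˣ × ↥(normOneUnits (conjLocal L (IsCMField.complexConj L) v)))) : Set ((LocalRing L v)ˣ × ↥(normOneUnits (conjLocal L (IsCMField.complexConj L) v)))))⁻¹ : ℝ) : ℂ) *
          (((UnitaryGroup.cmTorusCharPair L v ψ.1 ψ.2 (torusChart L v m) : ℂˣ) : ℂ) *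
            (vanDijkWeight L v (torusChart L v m) *
              classOrbitalIntegral mQv φ (ConjClasses.mk (((torusChart L v m : ↥(cmBorelTriple L 3 v).M) : ↥(unitaryGroupOfForm (conjLocal L (IsCMField.complexConj L) v) (cmLocalForm L 3 v))) : Gqs L v)))) := by
    intro ψ m
    rw [cmTorusCharPair_torusChart, ← pairChar_apply]
    show (((2 * μM.real ((((Submonoid.pi Set.univ (fun w : PlacesOver L v => (w.1.adicCompletionIntegers L).toSubring.toSubmonoid)).units.prod (⊤ : Subgroup ↥(normOneUnits (conjLocal L (IsCMField.complexConj L) v)))) : Subgroup ((LocalRing L v)ˣ × ↥(normOneUnits (conjLocal L (IsCMField.complexConj L) v)))) : Set ((LocalRing L v)ˣ × ↥(normOneUnits (conjLocal L (IsCMField.complexConj L) v)))))⁻¹ : ℝ) : ℂ) * (vanDijkWeight L v (torusChart L v m) *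
      classOrbitalIntegral mQv φ (ConjClasses.mk (((torusChart L v m : ↥(cmBorelTriple L 3 v).M) : ↥(unitaryGroupOfForm (conjLocal L (IsCMField.complexConj L) v) (cmLocalForm L 3 v))) : Gqs L v))) * (((pairChar L v ψ) m : ℂˣ) : ℂ) = _
    ring
  simp_rw [hF]
  rw [integral_const_mul, integral_const_mul, hsub, h1, ← mul_add, ← two_mul, ← mul_assoc]
  congr 1
  push_cast
  ring

end Summit.HodgeConjecture.HodgeConjecture.Cruxes.H413.F0P3cStCharTSPsmTransport

end
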